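import Literature.NumberTheory.Automorphic.QuaternionEuclideanEmbedding
import Mathlib.MeasureTheory.Measure.Lebesgue.VolumeOfBalls
import HarnessLib

/-!
# Counting lattice points by reduced norm: `#{b ∈ L | nrd b ≤ T} ~ (π²/2) T² / covol(ψ L)`

Topic `NumberTheory/Automorphic`; theorems only (no definition, no named fact, no instance).
For a full `ℤ`-lattice `L` of a totally definite quaternion algebra `B` over `ℚ` and the
Euclidean model `ψ : B → ℝ⁴`, `‖ψ x‖² = nrd x` (`QuaternionEuclideanEmbedding.lean`),

  `#{b ∈ L | nrd(b) ≤ T} / T² ⟶ (π² / 2) / covol(ψ L)`   (`T → ∞`)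

(`tendsto_ncard_reducedNorm_le_div_sq`): the points of `ψ(L)` in the ball of radius `√T` are
counted by Mathlib's `ZLattice.covolume.tendsto_card_le_div'` (gauge `F(x) = ‖x‖⁴`,
homogeneous of degree `4 = dim ℝ⁴`), the unit ball of `ℝ⁴` has volume `π²/2`
(`EuclideanSpace.volume_closedBall`, `Γ(3) = 2`) and its boundary sphere is null. This is the
geometry-of-numbers input of the lattice-point proof of Eichler's mass formula
(`brandtModule_massFormula`; Voight §25.4, §26.2; Vignéras V §2 obtains the same constant from
the Tamagawa measure).

## References

* M.-F. Vignéras, *Arithmétique des algèbres de quaternions*, LNM 800 (1980), Ch. V §2 [VignerasLNM800].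
* J. Voight, *Quaternion Algebras*, GTM 288 (2021), §17.7, §25.4.
-/

noncomputable section

open scoped Pointwise InnerProductSpace RealInnerProductSpace
open MeasureTheory Module Filter Topology Metric

universe u

namespace Literature.NumberTheory.Automorphic

variable {B : Type u} [Ring B] [Algebra ℚ B] [IsQuaternionAlgebra ℚ B]

/-- The volume of the unit ball of `ℝ⁴` is `π² / 2`. [folklore] -/
theorem volume_real_closedBall_euclideanSpace_fin_four :
    volume.real (closedBall (0 : EuclideanSpace ℝ (Fin 4)) 1) = Real.pi ^ 2 / 2 := by
  rw [measureReal_def, EuclideanSpace.volume_closedBall, Fintype.card_fin, ENNReal.toReal_mul, ENNReal.toReal_pow,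
    ENNReal.toReal_ofReal zero_le_one, one_pow, one_mul, ENNReal.toReal_ofReal]
  · have hG : Real.Gamma ((4 : ℕ) / 2 + 1 : ℝ) = 2 := by
      rw [show ((4 : ℕ) / 2 + 1 : ℝ) = (2 : ℕ) + 1 by norm_num, Real.Gamma_nat_eq_factorial]
      norm_num
    rw [hG, show Real.sqrt Real.pi ^ 4 = (Real.sqrt Real.pi ^ 2) ^ 2 by ring, Real.sq_sqrt Real.pi_pos.le]
  · positivity

/-- The sub-level set of `‖x‖⁴` at `1` is the closed unit ball. [folklore] -/
theorem setOf_norm_pow_four_le_one :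
    {x ∈ (Set.univ : Set (EuclideanSpace ℝ (Fin 4))) | ‖x‖ ^ 4 ≤ 1} = closedBall 0 1 := by
  ext x
  simp only [Set.mem_setOf_eq, Set.mem_univ, true_and, mem_closedBall, dist_zero_right]
  exact pow_le_one_iff_of_nonneg (norm_nonneg _) (by norm_num)

/-- **Lattice points of bounded reduced norm**: for a full lattice `L` of a totally definite
quaternion algebra over `ℚ`, `#{b ∈ L | nrd b ≤ T} / T² → (π²/2) / covol(ψ L)` as `T → ∞`
(Mathlib `ZLattice.covolume.tendsto_card_le_div'` for `ψ(L) ⊆ ℝ⁴` with the gauge `‖x‖⁴`).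
[cite: VignerasLNM800, Ch. V §2 (volume computation); Voight GTM 288 §25.4] -/
theorem tendsto_ncard_reducedNorm_le_div_sq (hdef : IsTotallyDefinite ℚ B)
    (ψ : B →ₗ[ℚ] EuclideanSpace ℝ (Fin 4)) (hψs : Submodule.span ℝ (Set.range ψ) = ⊤)
    (hψn : ∀ x, ‖ψ x‖ ^ 2 = ((reducedNorm ℚ B x : ℚ) : ℝ)) {L : Submodule ℤ B} (hL : IsFullLattice B L) :
    Tendsto (fun T : ℝ => (({b : B | b ∈ L ∧ ((reducedNorm ℚ B b : ℚ) : ℝ) ≤ T} : Set B).ncard : ℝ) / T ^ 2)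
      atTop (𝓝 (Real.pi ^ 2 / 2 / covol ψ L)) := by
  classical
  have hψi : Function.Injective ψ := injective_euclideanEmbedding ψ hψn hdef
  obtain ⟨bL⟩ := hL.nonempty_basis_fin_four
  obtain ⟨b, -, hspan⟩ := exists_basis_latticeMap_eq_span ψ hψs hL bL
  -- Mathlib's lattice point count with the gauge `‖x‖⁴`
  have hX : ∀ ⦃x : EuclideanSpace ℝ (Fin 4)⦄ ⦃r : ℝ⦄, x ∈ (Set.univ : Set _) → 0 < r → r • x ∈ (Set.univ : Set _) :=
    fun _ _ _ _ => Set.mem_univ _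
  have h₁ : ∀ (x : EuclideanSpace ℝ (Fin 4)) ⦃r : ℝ⦄, 0 ≤ r →
      (fun x : EuclideanSpace ℝ (Fin 4) => ‖x‖ ^ 4) (r • x) =
        r ^ finrank ℝ (EuclideanSpace ℝ (Fin 4)) * (fun x : EuclideanSpace ℝ (Fin 4) => ‖x‖ ^ 4) x := by
    intro x r hr
    simp only [finrank_euclideanSpace_fin, norm_smul, Real.norm_eq_abs, abs_of_nonneg hr, mul_pow]
  have h₂ : Bornology.IsBounded {x ∈ (Set.univ : Set (EuclideanSpace ℝ (Fin 4))) | ‖x‖ ^ 4 ≤ 1} := by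
    rw [setOf_norm_pow_four_le_one]; exact isBounded_closedBall
  have h₃ : MeasurableSet {x ∈ (Set.univ : Set (EuclideanSpace ℝ (Fin 4))) | ‖x‖ ^ 4 ≤ 1} := by
    rw [setOf_norm_pow_four_le_one]; exact measurableSet_closedBall
  have h₄ : volume (frontier {x ∈ (Set.univ : Set (EuclideanSpace ℝ (Fin 4))) | ‖x‖ ^ 4 ≤ 1}) = 0 := by
    rw [setOf_norm_pow_four_le_one, frontier_closedBall (0 : EuclideanSpace ℝ (Fin 4)) one_ne_zero]
    exact Measure.addHaar_sphere volume 0 1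
  have key := ZLattice.covolume.tendsto_card_le_div' (Submodule.span ℤ (Set.range b)) hX h₁ h₂ h₃ h₄
  rw [setOf_norm_pow_four_le_one, volume_real_closedBall_euclideanSpace_fin_four,
    ← covol_eq_covolume_span ψ b hspan] at key
  -- substitute `c = T²`
  have key2 := key.comp (tendsto_pow_atTop (n := 2) two_ne_zero)
  refine key2.congr' ?_
  filter_upwards [eventually_ge_atTop (0 : ℝ)] with T hT
  simp only [Function.comp_apply, Set.mem_univ, true_and]
  congr 1
  -- the two counted sets correspond under `ψ`
  have hset : ({x : EuclideanSpace ℝ (Fin 4) | ‖x‖ ^ 4 ≤ T ^ 2} ∩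
      ((Submodule.span ℤ (Set.range b) : Submodule ℤ (EuclideanSpace ℝ (Fin 4))) : Set (EuclideanSpace ℝ (Fin 4)))) =
      ψ '' {b : B | b ∈ L ∧ ((reducedNorm ℚ B b : ℚ) : ℝ) ≤ T} := by
    ext x
    simp only [Set.mem_inter_iff, Set.mem_setOf_eq, SetLike.mem_coe, Set.mem_image]
    constructor
    · rintro ⟨hx, hxL⟩
      rw [← hspan, mem_latticeMap_iff] at hxL
      obtain ⟨c, hc, rfl⟩ := hxL
      refine ⟨c, ⟨hc, ?_⟩, rfl⟩
      have h4 : ‖ψ c‖ ^ 4 = (((reducedNorm ℚ B c : ℚ) : ℝ)) ^ 2 := by rw [← hψn, ← pow_mul]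
      rw [h4] at hx
      have hn : (0 : ℝ) ≤ ((reducedNorm ℚ B c : ℚ) : ℝ) := by rw [← hψn]; positivity
      exact (sq_le_sq₀ hn hT).mp hx
    · rintro ⟨c, ⟨hc, hcT⟩, rfl⟩
      refine ⟨?_, ?_⟩
      · have h4 : ‖ψ c‖ ^ 4 = (((reducedNorm ℚ B c : ℚ) : ℝ)) ^ 2 := by rw [← hψn, ← pow_mul]
        rw [h4]
        have hn : (0 : ℝ) ≤ ((reducedNorm ℚ B c : ℚ) : ℝ) := by rw [← hψn]; positivity
        exact (sq_le_sq₀ hn hT).mpr hcT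
      · rw [← hspan, mem_latticeMap_iff]; exact ⟨c, hc, rfl⟩
  rw [hset, Nat.card_image_of_injective hψi, Nat.card_coe_set_eq]

end Literature.NumberTheory.Automorphic
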